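import Literature.NumberTheory.EllipticCurves.PAdicMeasureTransformBranches
import Literature.NumberTheory.EllipticCurves.PAdicLFunctionPlusMult
import Literature.NumberTheory.EllipticCurves.PAdicLFunctionInterpolationProofs
import HarnessLib

/-!
# The `ω^i`-branches of the ONE-TERM (multiplicative, `p ∣ N`) Mazur–Tate–Teitelbaum measures
# INTERPOLATE at the wild characters (proofs only)

Topic `NumberTheory/EllipticCurves`; namespace `Literature.NumberTheory.EllipticCurves`. THEOREMS ONLY
(no definition, no named fact; D-0014, D-0026). The multiplicative twin of
`PAdicLFunction[Minus]BranchInterpolationProofs`: at a prime `p ∣ N` the MTT measure of the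
allowable root `α = a_p(f) = ±1` has ONE term, `μ^±_{f,α}(a + pⁿℤ_p) = α⁻ⁿ[a/pⁿ]^±_f`
(`msdPlusMeasureMult`, `msdMinusMeasureMult`; Mazur–Tate–Teitelbaum, Invent. Math. 84 (1986) §I.10
(10.1) with `ε(p) = 0`), and its `ω^i`-branches `padicLFunctionPlusBranchMult f α i` /
`padicLFunctionMinusBranchMult f α i` (§I.13) are again the trivial branches of the twisted measures
`ω^i μ^±` (`branchTwist`, `weightedRiemannSum_eq` of `PAdicMeasureTransformBranches`). Hence, for a
bounded distribution `μ^±_{f,α}` (tree: `sum_fiber_msdPlus/MinusMeasureMult_succ_eq_of_coeffField`,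
`exists_norm_ratPlusSymbol_le`, `exists_forall_norm_ratMinusSymbol_le_of_maninDrinfeld`) and EVERY
character `κ` of `Γ` of level `p^{m+1} ≥ p^{e₀}` — primitive or not, there being no lower-level term:

  `L^±_p(f, α, ω^i, κ(γ) − 1) = ∑_a κ(a) ω(a)^i μ^±(a + p^{m+1}ℤ_p) = α^{−(m+1)} ∑_a κ(a) ω(a)^i [a/p^{m+1}]^±_f`

(`hasSum_padicLPlusBranchMultCoeff_mul_pow[_of_distribution]`, `hasSum_padicLMinusBranchMultCoeff_…`;
MTT §I.13 "`L_p(P, χψ) = ∫ χψ dμ`", §I.14 with `ε(p) = 0`), together with the boundedness of the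
coefficients (`norm_coeff_padicLFunctionPlus/MinusBranchMult_le`, MTT §I.12).

Motivation (cell `b2b-bsdres`, sub-cell additive-p2 / N10 defect 2, (M) rows): the power-series
dictionary between the E-normalised tame branch of `E = E♭ ⊗ χ_{p*}` with `E♭` MULTIPLICATIVE at `p`
and `L^±_p(f_{E♭}, a_p(E♭), ω^{(p−1)/2}, T)`, the object of the (M) Kato / Wuthrich bricks.

What is NOT here: the two-term (good ordinary) measures (`PAdicLFunction[Minus]BranchInterpolationProofs`);
Birch's formula; `p = 2` specifics.

References: B. Mazur, J. Tate, J. Teitelbaum, Invent. Math. 84 (1986) §I.10 (10.1), §I.11–I.14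
[MazurTateTeitelbaum1986Invent]; L. C. Washington, GTM 83, §7.2, §12.2 [Washington1997].
-/

noncomputable section

open Filter Topology

open scoped MatrixGroups ModularForm

namespace Literature.NumberTheory.EllipticCurves

open CongruenceSubgroup Literature.NumberTheory.EllipticCurves.ModularForms

variable {p : ℕ} [Fact p.Prime] {N : ℕ} (f : CuspForm (Gamma0 N) 2) (α : ℚ_[p])

/-! ### The one-term PLUS measure -/

section PlusMult

/-- **The `ω^i`-branch of the one-term plus measure interpolates `ω^i μ⁺_{f,α}` at every character
of `Γ`** (MTT §I.13): for `μ⁺ = msdPlusMeasureMult f α` a bounded distribution, every `m` with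
`p^{m+1} ≥ p^{e₀}` and every Dirichlet character `κ` mod `p^{m+1}` with values in `ℂ_p` which is a
character of `Γ`, `∑_k [T^k]L⁺_p(f,α,ω^i,T)·(κ(γ)−1)^k = ∑_a κ(a)·μ⁺(a+p^{m+1}ℤ_p)·ω(a)^i`.
[cite: MazurTateTeitelbaum1986Invent, §I.13–I.14] -/
theorem hasSum_padicLPlusBranchMultCoeff_mul_pow_of_distribution
    (hdist : ∀ (n : ℕ) (a : ZMod (p ^ n)),
      ∑ b ∈ Finset.univ.filter (fun b : ZMod (p ^ (n + 1)) ↦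
        ZMod.castHom (pow_dvd_pow p n.le_succ) (ZMod (p ^ n)) b = a), msdPlusMeasureMult f α (n + 1) b =
        msdPlusMeasureMult f α n a)
    {C : ℝ} (hC : ∀ (n : ℕ) (a : ZMod (p ^ n)), ‖msdPlusMeasureMult f α n a‖ ≤ C) (i : ℕ) {m : ℕ}
    (hm : cyclotomicExponent p ≤ m + 1) (κ : DirichletCharacter ℂ_[p] (p ^ (m + 1))) (heven : κ.Even)
    (hord : ∃ j : ℕ, orderOf κ = p ^ j) :
    HasSum (fun k : ℕ ↦ algebraMap ℚ_[p] ℂ_[p] (padicLPlusBranchMultCoeff f α i k) *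
        (κ (cyclotomicGenerator p : ZMod (p ^ (m + 1))) - 1) ^ k)
      (∑ a : ZMod (p ^ (m + 1)), κ a * algebraMap ℚ_[p] ℂ_[p] (msdPlusMeasureMult f α (m + 1) a *
        teichWeight p i (ZMod.castHom (pow_dvd_pow p hm) (ZMod (p ^ cyclotomicExponent p)) a))) := by
  have h := hasSum_limUnder_riemannSum_mul_pow_of_distribution
    (μ := branchTwist i (msdPlusMeasureMult f α)) (RS := padicLPlusBranchMultRiemannSum f α i)
    (fun k n ↦ weightedRiemannSum_eq (RS := padicLPlusBranchMultRiemannSum f α i) (fun _ _ ↦ rfl)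
      hdist k n)
    (branchTwist_distribution hdist i) (norm_branchTwist_le hC i) κ heven hord
  simp_rw [branchTwist_apply_of_distribution hdist i hm] at h
  exact h

/-- **Evaluation of `ω^i μ⁺_{f,α}` at level `p^{m+1}`** — ONE term, no primitivity needed:
`∑_a κ(a)·μ⁺(a+p^{m+1}ℤ_p)·ω(a)^i = α^{−(m+1)}∑_a κ(a)·ω(a)^i·[a/p^{m+1}]⁺_f` (MTT §I.10 (10.1) with
`ε(p) = 0`). [cite: MazurTateTeitelbaum1986Invent, §I.10 (10.1) and §I.14] -/
theorem sum_mul_msdPlusMeasureMult_mul_teichWeight (i : ℕ) {m : ℕ}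
    (hm : cyclotomicExponent p ≤ m + 1) (κ : DirichletCharacter ℂ_[p] (p ^ (m + 1))) :
    ∑ a : ZMod (p ^ (m + 1)), κ a * algebraMap ℚ_[p] ℂ_[p] (msdPlusMeasureMult f α (m + 1) a *
        teichWeight p i (ZMod.castHom (pow_dvd_pow p hm) (ZMod (p ^ cyclotomicExponent p)) a)) =
      algebraMap ℚ_[p] ℂ_[p] (α⁻¹ ^ (m + 1)) *
        ∑ a : ZMod (p ^ (m + 1)), κ a *
          algebraMap ℚ_[p] ℂ_[p] (teichWeight p i (ZMod.castHom (pow_dvd_pow p hm)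
            (ZMod (p ^ cyclotomicExponent p)) a)) *
          (ratPlusSymbol f ((a.val : ℚ) / ((p ^ (m + 1) : ℕ) : ℚ)) : ℂ_[p]) := by
  rw [Finset.mul_sum]
  refine Finset.sum_congr rfl fun a _ ↦ ?_
  simp only [msdPlusMeasureMult, map_mul, map_ratCast, Nat.cast_pow]
  ring

/-- **Interpolation of the `ω^i`-branch of the one-term plus measure** (MTT §I.14 with `ε(p) = 0`):
for EVERY character `κ` of `Γ` of level `p^{m+1} ≥ p^{e₀}`,
`L⁺_p(f, α, ω^i, κ(γ) − 1) = α^{−(m+1)} ∑_{a mod p^{m+1}} κ(a) ω(a)^i [a/p^{m+1}]⁺_f`.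
[cite: MazurTateTeitelbaum1986Invent, §I.13–I.14] -/
theorem hasSum_padicLPlusBranchMultCoeff_mul_pow
    (hdist : ∀ (n : ℕ) (a : ZMod (p ^ n)),
      ∑ b ∈ Finset.univ.filter (fun b : ZMod (p ^ (n + 1)) ↦
        ZMod.castHom (pow_dvd_pow p n.le_succ) (ZMod (p ^ n)) b = a), msdPlusMeasureMult f α (n + 1) b =
        msdPlusMeasureMult f α n a)
    {C : ℝ} (hC : ∀ (n : ℕ) (a : ZMod (p ^ n)), ‖msdPlusMeasureMult f α n a‖ ≤ C) (i : ℕ) {m : ℕ}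
    (hm : cyclotomicExponent p ≤ m + 1) (κ : DirichletCharacter ℂ_[p] (p ^ (m + 1))) (heven : κ.Even)
    (hord : ∃ j : ℕ, orderOf κ = p ^ j) :
    HasSum (fun k : ℕ ↦ algebraMap ℚ_[p] ℂ_[p] (padicLPlusBranchMultCoeff f α i k) *
        (κ (cyclotomicGenerator p : ZMod (p ^ (m + 1))) - 1) ^ k)
      (algebraMap ℚ_[p] ℂ_[p] (α⁻¹ ^ (m + 1)) *
        ∑ a : ZMod (p ^ (m + 1)), κ a *
          algebraMap ℚ_[p] ℂ_[p] (teichWeight p i (ZMod.castHom (pow_dvd_pow p hm)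
            (ZMod (p ^ cyclotomicExponent p)) a)) *
          (ratPlusSymbol f ((a.val : ℚ) / ((p ^ (m + 1) : ℕ) : ℚ)) : ℂ_[p])) := by
  rw [← sum_mul_msdPlusMeasureMult_mul_teichWeight f α i hm κ]
  exact hasSum_padicLPlusBranchMultCoeff_mul_pow_of_distribution f α hdist hC i hm κ heven hord

/-- **The `ω^i`-branches of the one-term plus measure are bounded**: `‖[T^k]L⁺_p(f,α,ω^i,T)‖ ≤ C` when
`μ⁺_{f,α}` is a distribution bounded by `C` (MTT §I.12; `norm_limUnder_riemannSum_le_of_distribution`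
for the twisted distribution `ω^i μ⁺`). [cite: MazurTateTeitelbaum1986Invent, §I.12–I.13] -/
theorem norm_coeff_padicLFunctionPlusBranchMult_le
    (hdist : ∀ (n : ℕ) (a : ZMod (p ^ n)),
      ∑ b ∈ Finset.univ.filter (fun b : ZMod (p ^ (n + 1)) ↦
        ZMod.castHom (pow_dvd_pow p n.le_succ) (ZMod (p ^ n)) b = a), msdPlusMeasureMult f α (n + 1) b =
        msdPlusMeasureMult f α n a)
    {C : ℝ} (hC : ∀ (n : ℕ) (a : ZMod (p ^ n)), ‖msdPlusMeasureMult f α n a‖ ≤ C) (i k : ℕ) :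
    ‖PowerSeries.coeff k (padicLFunctionPlusBranchMult f α i)‖ ≤ C := by
  rw [coeff_padicLFunctionPlusBranchMult]
  exact norm_limUnder_riemannSum_le_of_distribution (μ := branchTwist i (msdPlusMeasureMult f α))
    (RS := padicLPlusBranchMultRiemannSum f α i)
    (fun k n ↦ weightedRiemannSum_eq (RS := padicLPlusBranchMultRiemannSum f α i) (fun _ _ ↦ rfl)
      hdist k n)
    (branchTwist_distribution hdist i) (norm_branchTwist_le hC i) k

end PlusMult

/-! ### The one-term MINUS measure -/

section MinusMult

/-- **The `ω^i`-branch of the one-term minus measure interpolates `ω^i μ⁻_{f,α}` at every character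
of `Γ`** (MTT §I.13): `∑_k [T^k]L⁻_p(f,α,ω^i,T)·(κ(γ)−1)^k = ∑_a κ(a)·μ⁻(a+p^{m+1}ℤ_p)·ω(a)^i`.
[cite: MazurTateTeitelbaum1986Invent, §I.13–I.14] -/
theorem hasSum_padicLMinusBranchMultCoeff_mul_pow_of_distribution
    (hdist : ∀ (n : ℕ) (a : ZMod (p ^ n)),
      ∑ b ∈ Finset.univ.filter (fun b : ZMod (p ^ (n + 1)) ↦
        ZMod.castHom (pow_dvd_pow p n.le_succ) (ZMod (p ^ n)) b = a),
          msdMinusMeasureMult f α (n + 1) b = msdMinusMeasureMult f α n a)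
    {C : ℝ} (hC : ∀ (n : ℕ) (a : ZMod (p ^ n)), ‖msdMinusMeasureMult f α n a‖ ≤ C) (i : ℕ) {m : ℕ}
    (hm : cyclotomicExponent p ≤ m + 1) (κ : DirichletCharacter ℂ_[p] (p ^ (m + 1))) (heven : κ.Even)
    (hord : ∃ j : ℕ, orderOf κ = p ^ j) :
    HasSum (fun k : ℕ ↦ algebraMap ℚ_[p] ℂ_[p] (padicLMinusBranchMultCoeff f α i k) *
        (κ (cyclotomicGenerator p : ZMod (p ^ (m + 1))) - 1) ^ k)
      (∑ a : ZMod (p ^ (m + 1)), κ a * algebraMap ℚ_[p] ℂ_[p] (msdMinusMeasureMult f α (m + 1) a *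
        teichWeight p i (ZMod.castHom (pow_dvd_pow p hm) (ZMod (p ^ cyclotomicExponent p)) a))) := by
  have h := hasSum_limUnder_riemannSum_mul_pow_of_distribution
    (μ := branchTwist i (msdMinusMeasureMult f α)) (RS := padicLMinusBranchMultRiemannSum f α i)
    (fun k n ↦ weightedRiemannSum_eq (RS := padicLMinusBranchMultRiemannSum f α i) (fun _ _ ↦ rfl)
      hdist k n)
    (branchTwist_distribution hdist i) (norm_branchTwist_le hC i) κ heven hord
  simp_rw [branchTwist_apply_of_distribution hdist i hm] at h
  exact h

/-- **Evaluation of `ω^i μ⁻_{f,α}` at level `p^{m+1}`** (one term):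
`∑_a κ(a)·μ⁻(a+p^{m+1}ℤ_p)·ω(a)^i = α^{−(m+1)}∑_a κ(a)·ω(a)^i·[a/p^{m+1}]⁻_f`.
[cite: MazurTateTeitelbaum1986Invent, §I.10 (10.1) and §I.14] -/
theorem sum_mul_msdMinusMeasureMult_mul_teichWeight (i : ℕ) {m : ℕ}
    (hm : cyclotomicExponent p ≤ m + 1) (κ : DirichletCharacter ℂ_[p] (p ^ (m + 1))) :
    ∑ a : ZMod (p ^ (m + 1)), κ a * algebraMap ℚ_[p] ℂ_[p] (msdMinusMeasureMult f α (m + 1) a *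
        teichWeight p i (ZMod.castHom (pow_dvd_pow p hm) (ZMod (p ^ cyclotomicExponent p)) a)) =
      algebraMap ℚ_[p] ℂ_[p] (α⁻¹ ^ (m + 1)) *
        ∑ a : ZMod (p ^ (m + 1)), κ a *
          algebraMap ℚ_[p] ℂ_[p] (teichWeight p i (ZMod.castHom (pow_dvd_pow p hm)
            (ZMod (p ^ cyclotomicExponent p)) a)) *
          (ratMinusSymbol f ((a.val : ℚ) / ((p ^ (m + 1) : ℕ) : ℚ)) : ℂ_[p]) := by
  rw [Finset.mul_sum]
  refine Finset.sum_congr rfl fun a _ ↦ ?_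
  simp only [msdMinusMeasureMult, map_mul, map_ratCast, Nat.cast_pow]
  ring

/-- **Interpolation of the `ω^i`-branch of the one-term minus measure** (MTT §I.14 with `ε(p) = 0`):
`L⁻_p(f, α, ω^i, κ(γ) − 1) = α^{−(m+1)} ∑_{a mod p^{m+1}} κ(a) ω(a)^i [a/p^{m+1}]⁻_f` for every
character `κ` of `Γ` of level `p^{m+1} ≥ p^{e₀}`. [cite: MazurTateTeitelbaum1986Invent, §I.13–I.14] -/
theorem hasSum_padicLMinusBranchMultCoeff_mul_pow
    (hdist : ∀ (n : ℕ) (a : ZMod (p ^ n)),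
      ∑ b ∈ Finset.univ.filter (fun b : ZMod (p ^ (n + 1)) ↦
        ZMod.castHom (pow_dvd_pow p n.le_succ) (ZMod (p ^ n)) b = a),
          msdMinusMeasureMult f α (n + 1) b = msdMinusMeasureMult f α n a)
    {C : ℝ} (hC : ∀ (n : ℕ) (a : ZMod (p ^ n)), ‖msdMinusMeasureMult f α n a‖ ≤ C) (i : ℕ) {m : ℕ}
    (hm : cyclotomicExponent p ≤ m + 1) (κ : DirichletCharacter ℂ_[p] (p ^ (m + 1))) (heven : κ.Even)
    (hord : ∃ j : ℕ, orderOf κ = p ^ j) :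
    HasSum (fun k : ℕ ↦ algebraMap ℚ_[p] ℂ_[p] (padicLMinusBranchMultCoeff f α i k) *
        (κ (cyclotomicGenerator p : ZMod (p ^ (m + 1))) - 1) ^ k)
      (algebraMap ℚ_[p] ℂ_[p] (α⁻¹ ^ (m + 1)) *
        ∑ a : ZMod (p ^ (m + 1)), κ a *
          algebraMap ℚ_[p] ℂ_[p] (teichWeight p i (ZMod.castHom (pow_dvd_pow p hm)
            (ZMod (p ^ cyclotomicExponent p)) a)) *
          (ratMinusSymbol f ((a.val : ℚ) / ((p ^ (m + 1) : ℕ) : ℚ)) : ℂ_[p])) := by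
  rw [← sum_mul_msdMinusMeasureMult_mul_teichWeight f α i hm κ]
  exact hasSum_padicLMinusBranchMultCoeff_mul_pow_of_distribution f α hdist hC i hm κ heven hord

/-- **The `ω^i`-branches of the one-term minus measure are bounded**:
`‖[T^k]L⁻_p(f,α,ω^i,T)‖ ≤ C` when `μ⁻_{f,α}` is a distribution bounded by `C` (the tree's
`norm_padicLMinusBranchMultCoeff_le` through `coeff_padicLFunctionMinusBranchMult`).
[cite: MazurTateTeitelbaum1986Invent, §I.12–I.13] -/
theorem norm_coeff_padicLFunctionMinusBranchMult_le
    (hdist : ∀ (n : ℕ) (a : ZMod (p ^ n)),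
      ∑ b ∈ Finset.univ.filter (fun b : ZMod (p ^ (n + 1)) ↦
        ZMod.castHom (pow_dvd_pow p n.le_succ) (ZMod (p ^ n)) b = a),
          msdMinusMeasureMult f α (n + 1) b = msdMinusMeasureMult f α n a)
    {C : ℝ} (hC : ∀ (n : ℕ) (a : ZMod (p ^ n)), ‖msdMinusMeasureMult f α n a‖ ≤ C) (i k : ℕ) :
    ‖PowerSeries.coeff k (padicLFunctionMinusBranchMult f α i)‖ ≤ C := by
  rw [coeff_padicLFunctionMinusBranchMult]
  exact norm_padicLMinusBranchMultCoeff_le f α hdist hC i k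

end MinusMult

end Literature.NumberTheory.EllipticCurves

end
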